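import Mathlib
import Summits.Ventures.HodgeRepro.CMType
import Summits.Ventures.HodgeRepro.HodgeSets
import Summits.Ventures.HodgeRepro.CMRank
import Summits.Ventures.HodgeRepro.Primitive
import Summits.Ventures.HodgeRepro.MuTable
import Summits.Ventures.HodgeRepro.MuDecide

/-!
# Transport of the weight census under the two Galois actions (blind cell `pub-hodge-repro`, seat p2)

The number of distinct columns of the μ-table is invariant under the left action `Φ ↦ g • Φ` (the columns
are reindexed by `h ↦ h g`) and under the right action `Φ ↦ Φ h` (`rmul`, the engine's Galois twist; the
columns are permuted by `s ↦ s h⁻¹`).  Together with `cmRank_smul` / `cmRank_rmul` this carries the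
hypothesis of the pairs theorem (`MuPairsRank.lean`) from one representative to its whole two-sided orbit.
-/

open Finset
open scoped Pointwise

namespace HodgeRepro

variable {G : Type*} [Group G] [DecidableEq G] [Fintype G]

omit [Fintype G] in
/-- Weights under a left translate of the type: `w^{gΦ}_s(h) = w^Φ_s(hg)`. -/
theorem weightN_smul (g : G) (Φ : Finset G) (s : G) :
    weightN (g • Φ) s = fun h => weightN Φ s (h * g) := by
  ext h
  simp only [weightN, smul_smul]

omit [Fintype G] in
/-- Weights under a right translate of the type: `w^{Φk}_s = w^Φ_{s k⁻¹}`. -/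
theorem weightN_rmul (Φ : Finset G) (k s : G) : weightN (rmul Φ k) s = weightN Φ (s * k⁻¹) := by
  ext h
  have : s ∈ h • rmul Φ k ↔ s * k⁻¹ ∈ h • Φ := by
    rw [smul_rmul, mem_rmul]
  simp only [weightN, this]

/-- The weight census is invariant under the left action `Φ ↦ g • Φ`. -/
theorem card_weightsN_smul (g : G) (Φ : Finset G) : (weightsN (g • Φ)).card = (weightsN Φ).card := by
  unfold weightsN
  have h : univ.image (weightN (g • Φ)) = (univ.image (weightN Φ)).image (fun v : G → ℕ => fun h => v (h * g)) := by
    rw [image_image]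
    refine image_congr fun s _ => ?_
    exact weightN_smul g Φ s
  rw [h, card_image_of_injective]
  intro v w hvw
  ext h
  have := congrFun hvw (h * g⁻¹)
  simpa using this

/-- The weight census is invariant under the right action `Φ ↦ Φ k` (the engine's Galois twist). -/
theorem card_weightsN_rmul (Φ : Finset G) (k : G) : (weightsN (rmul Φ k)).card = (weightsN Φ).card := by
  unfold weightsN
  have h : univ.image (weightN (rmul Φ k)) = univ.image (weightN Φ) := by
    ext v
    simp only [mem_image, mem_univ, true_and]
    constructor
    · rintro ⟨s, rfl⟩
      exact ⟨s * k⁻¹, (weightN_rmul Φ k s).symm⟩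
    · rintro ⟨s, rfl⟩
      refine ⟨s * k, ?_⟩
      rw [weightN_rmul, mul_inv_cancel_right]
  rw [h]

end HodgeRepro
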